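import Summits.BirchSwinnertonDyer.Rank1Residual.Partition.EisensteinKernelDiscriminantType
import Summits.BirchSwinnertonDyer.Rank1Residual.Partition.EisensteinKernelTypeMultiplicative
import HarnessLib

/-!
# The Greenberg–Vatsal type at a MULTIPLICATIVE `p` from the kernel discriminant, WITHOUT the Tate
# curve: `GVPar W p ↔ (0 < D ↔ p ∣ D)`; class X2 at `p = 3`

HONEST FRAMING (cell `b2b-bsdres-*`, verbatim): the goal of the cell is to DELETE the
COMBINATION-SHAPED residual classes for ALL analytic-rank ≤ 1 curves over ℚ — "full BSD formula
for every rank ≤ 1 curve in class C" assembled STRICTLY from published theorems — so that the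
rank-≤1 remainder becomes exactly the CONSTRUCTION-SHAPED classes, which are TYPED (missing-input
Props), NOT attempted; this is not "finishing BSD". Off-peak literature typer `b2b-bsdres-lit-cgls`
(CGLS22 / GV00, the reducible = Eisenstein column), session 15, file 5: bookkeeping — theorems only,
no definition, no named fact, nothing booked, no label changed.

WHY. Sessions 11–13 decided the Greenberg–Vatsal type of an Eisenstein pair with a QUADRATIC kernel
character (every pair at `p = 3`) from its kernel discriminant `D`: `GVPar W p ↔ (0 < D ↔ p ∣ D)` — at
a good ordinary `p` unconditionally (`gvPar_iff_of_goodOrd`), at a multiplicative `p` GRANTED the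
Tate-uniformisation named facts `hT`, `hT'` (A40/A41), which entered only through the type-independence
`X2.not_gvPar_of_isRationalLine_of_mult` (the Tate line). Session 15 proved type-independence at a
multiplicative odd `p` WITHOUT the Tate curve (`not_gvPar_of_isRationalLine_of_hasMultiplicativeReduction`,
from Serre's `(χ *; 0 1)` inertia line, file `EisensteinKernelTypeMultiplicative`). This file records
the `hT`/`hT'`-free twins:

* `gvPar_iff_of_hasMultiplicativeReduction` — `GVPar W p ↔ (0 < D ↔ p ∣ D)` at a multiplicative odd
  `p`, for any rational line with quadratic kernel character of discriminant `D` (twin of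
  `gvPar_iff_of_mult`);
* `exists_kernelDisc_three_gvPar_iff_of_hasMultiplicativeReduction`, `classX2_three_gvPar_iff_tateFree`
  — class X2 at `p = 3` (O9 = X2 ∩ {r = 1}, N9 = X2 ∩ {r = 0} at `3`): the KDISC3 decision
  `GVPar W 3 ↔ (0 < D ↔ 3 ∣ D)` with the twist / explicit-formula data, now unconditional (twins of
  `exists_kernelDisc_three_gvPar_iff_of_mult`, `classX2_three_gvPar_iff`).

References: R. Greenberg, V. Vatsal, Invent. Math. 142 (2000), Thm. (1.3) [GreenbergVatsal2000];
J.-P. Serre, Invent. Math. 15 (1972) §1.11–1.12 [SerreInventiones1972]; J. H. Silverman, *AEC*, GTM 106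
(2009), III.2.3, X.5.4 [SilvermanAEC2009]; HOME/class-closure/O9/KDISC3-typer6.md;
HOME/b2b-bsdres-lit-cgls/CGLS-GV-TYPING.md §§18–20, §22.
-/

set_option autoImplicit false

noncomputable section

open scoped Classical NumberField

open WeierstrassCurve Literature.NumberTheory.EllipticCurves
  Literature.NumberTheory.EllipticCurves.Rank1Residual Field IsDedekindDomain

namespace Summit.BirchSwinnertonDyer.Rank1Residual

namespace KernelDisc

variable {W : WeierstrassCurve ℚ} {p : ℕ} [Fact p.Prime] {Φ : AddSubgroup (geomTorsion W (p : ℤ))}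

/-! ### The type from `D` at a multiplicative odd `p`, Tate-free -/

section GVType

variable (hΦ : IsRationalLine W p Φ) (hp2 : p ≠ 2) {D : ℤ} (hD0 : D ≠ 0) (hsq : Squarefree D)
  (hχ : ∀ σ : absoluteGaloisGroup ℚ, (∀ P ∈ Φ, σ • P = P) ↔ σ • geomSqrt (D : ℚ) = geomSqrt (D : ℚ))
  (hχ' : ∀ σ : absoluteGaloisGroup ℚ, (∀ P ∈ Φ, σ • P = -P) ↔ σ • geomSqrt (D : ℚ) = -geomSqrt (D : ℚ))

include hΦ hp2 hD0 hsq hχ hχ' in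
/-- **At an odd MULTIPLICATIVE `p` (globally minimal model), WITHOUT the Tate curve:
`GVPar W p ↔ (0 < D ↔ p ∣ D)`** for a rational line `Φ` with quadratic kernel character of
squarefree discriminant `D` — the `hT`/`hT'`-free twin of `gvPar_iff_of_mult`, through
`not_gvPar_of_isRationalLine_of_hasMultiplicativeReduction` (Serre's inertia line in place of the Tate
line). [cite: GreenbergVatsal2000, Thm. (1.3)] [cite: SerreInventiones1972, §1.12 (Cor. of Prop. 13)] -/
theorem gvPar_iff_of_hasMultiplicativeReduction [W.IsElliptic] [W.IsGloballyMinimal]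
    (hmult : W.HasMultiplicativeReductionAtPrime p) : GVPar W p ↔ (0 < D ↔ (p : ℤ) ∣ D) := by
  refine ⟨fun hB ↦ ?_, gvPar_of_iff hΦ hp2 hD0 hsq hχ hχ'⟩
  by_contra h
  exact not_gvPar_of_isRationalLine_of_hasMultiplicativeReduction hp2 hmult hΦ
    (fun hQ ↦ h ((gvType_iff hΦ hp2 hD0 hsq hχ hχ').mp hQ)) hB

end GVType

/-! ### Class X2 at `p = 3`, Tate-free -/

section Three

variable (W)

/-- **GV type at a multiplicative `3` from the kernel discriminant, WITHOUT the Tate curve** (class X2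
at `3`): for `E/ℚ` (globally minimal model) with `E[3]` reducible and multiplicative reduction at `3`
there are a rational line `Φ` and a squarefree `D ≠ 0` (kernel character = the quadratic character of
`ℚ(√D)`; every model of the twist `E^{(D)}` has a rational point of order `3`; `D` read off any
non-zero point of `Φ` by `D·s² = 4x₀³ + b₂x₀² + 2b₄x₀ + b₆`) with **`GVPar W 3 ↔ (0 < D ↔ 3 ∣ D)`**.
The `hT`/`hT'`-free twin of `exists_kernelDisc_three_gvPar_iff_of_mult`. [cite: GreenbergVatsal2000, Thm. (1.3)]
[cite: SerreInventiones1972, §1.12 (Cor. of Prop. 13)] -/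
theorem exists_kernelDisc_three_gvPar_iff_of_hasMultiplicativeReduction [W.IsElliptic]
    [W.IsGloballyMinimal] (hred : ¬ W.HasIrreducibleModPGaloisRep 3)
    (hmult : W.HasMultiplicativeReductionAtPrime 3) :
    ∃ (Φ : AddSubgroup (geomTorsion W ((3 : ℕ) : ℤ))) (D : ℤ), IsRationalLine W 3 Φ ∧ D ≠ 0 ∧
      Squarefree D ∧
      (∀ σ : absoluteGaloisGroup ℚ, (∀ P ∈ Φ, σ • P = P) ↔ σ • geomSqrt (D : ℚ) = geomSqrt (D : ℚ)) ∧
      (∀ (Wd : WeierstrassCurve ℚ) (C : VariableChange ℚ), C • Wd = W.quadraticTwist (D : ℚ) →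
        ∃ Q : Wd.toAffine.Point, addOrderOf Q = 3) ∧
      (∀ P ∈ Φ, P ≠ 0 → ∃ (x₀ s : ℚ) (y : (AlgebraicClosure ℚ))
          (h : (W.baseChange (AlgebraicClosure ℚ)).toAffine.Nonsingular (algebraMap ℚ (AlgebraicClosure ℚ) x₀) y),
        (P : W.geomPoints) = Affine.Point.some (algebraMap ℚ (AlgebraicClosure ℚ) x₀) y h ∧ s ≠ 0 ∧
          (D : ℚ) * s ^ 2 = 4 * x₀ ^ 3 + W.b₂ * x₀ ^ 2 + 2 * W.b₄ * x₀ + W.b₆) ∧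
      (GVPar W 3 ↔ (0 < D ↔ (3 : ℤ) ∣ D)) := by
  have h32 : (3 : ℕ) ≠ 2 := by decide
  obtain ⟨Φ, hΦ⟩ := exists_isRationalLine_of_not_irr W 3 hred
  have hq := isQuadratic_three hΦ
  obtain ⟨D, hD0, hsq, hχ⟩ := exists_kernelDisc hΦ h32 hq
  have hχ' := forall_smul_eq_neg_iff hΦ h32 hq hD0 hχ
  refine ⟨Φ, D, hΦ, hD0, hsq, hχ, fun Wd C hC ↦ exists_addOrderOf_eq_of_twist hΦ h32 hq hD0 hχ C hC,
    fun P hP hP0 ↦ exists_coord_of_mem hΦ h32 hq hD0 hχ hP hP0, ?_⟩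
  have := gvPar_iff_of_hasMultiplicativeReduction hΦ h32 hD0 hsq hχ hχ' hmult
  simpa using this

/-- **CLASS X2 at `p = 3`, WITHOUT the Tate curve** (`ClassX2 W 3`: reducible, multiplicative): the
Greenberg–Vatsal parity type of the pair is decided by its kernel discriminant,
`GVPar W 3 ↔ (0 < D ↔ 3 ∣ D)` (O9 = X2 ∩ {r = 1} and N9 = X2 ∩ {r = 0} at `3`), together with the
twist / explicit-formula data — the `hT`/`hT'`-free twin of `classX2_three_gvPar_iff`. Research route;
no claim about BSD is made here. [cite: GreenbergVatsal2000, Thm. (1.3)] -/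
theorem classX2_three_gvPar_iff_tateFree [W.IsElliptic] [W.IsGloballyMinimal] (hX2 : ClassX2 W 3) :
    ∃ (Φ : AddSubgroup (geomTorsion W ((3 : ℕ) : ℤ))) (D : ℤ), IsRationalLine W 3 Φ ∧ D ≠ 0 ∧
      Squarefree D ∧
      (∀ σ : absoluteGaloisGroup ℚ, (∀ P ∈ Φ, σ • P = P) ↔ σ • geomSqrt (D : ℚ) = geomSqrt (D : ℚ)) ∧
      (∀ (Wd : WeierstrassCurve ℚ) (C : VariableChange ℚ), C • Wd = W.quadraticTwist (D : ℚ) →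
        ∃ Q : Wd.toAffine.Point, addOrderOf Q = 3) ∧
      (∀ P ∈ Φ, P ≠ 0 → ∃ (x₀ s : ℚ) (y : (AlgebraicClosure ℚ))
          (h : (W.baseChange (AlgebraicClosure ℚ)).toAffine.Nonsingular (algebraMap ℚ (AlgebraicClosure ℚ) x₀) y),
        (P : W.geomPoints) = Affine.Point.some (algebraMap ℚ (AlgebraicClosure ℚ) x₀) y h ∧ s ≠ 0 ∧
          (D : ℚ) * s ^ 2 = 4 * x₀ ^ 3 + W.b₂ * x₀ ^ 2 + 2 * W.b₄ * x₀ + W.b₆) ∧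
      (GVPar W 3 ↔ (0 < D ↔ (3 : ℤ) ∣ D)) :=
  exists_kernelDisc_three_gvPar_iff_of_hasMultiplicativeReduction W hX2.2.1 hX2.2.2

end Three

end KernelDisc

end Summit.BirchSwinnertonDyer.Rank1Residual

end
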